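import Summits.SmoothPoincare4.SmoothPoincare4.Theorems.ConvexBisectionAcyclicBisectionExistsTwistProductChart
import HarnessLib

/-!
# The ambient page Dehn twist `Γ ∘ shear ∘ Γ⁻¹` on `ℝ⁴`: definition, smoothness near the base,
# `rho`-invariance, inverse (wave 6, brick G6-6 — second piece of (R-TWIST), the page Dehn twist
# DIFFEOMORPHISM along a charted page curve, for node N3a `node_STcurve` of stub `stub_STgeo` = NF4 N3,
# line `modp-braid-orbits`, crux `ConvexBisection.AcyclicBisectionExists`, item stmt-SmoothPoincare4-10508;
# registered sub-goal `helper_twistAmb_package`)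

With the product chart `Γ = prodChart g Φ : ℂ × ℝ² → ℝ⁴` of `…TwistProductChart.lean` (the page family
spread of an ambient annulus `Φ` of the page of direction `1`: `w ∘ Γ = w'`, `Γ (1/2, ·) = Φ`, a local
diffeomorphism on `twistDom ε = {‖2w'‖ < 1 + 2ε} × ℝ × (−1, 1)` with open image `O`), the ambient twist is

  `twistAmb p = Γ (w', u + σ β̂ r, r)`  for `p = Γ (w', u, r) ∈ O`   (any preimage: `twistAmb_prodChart`),
  `twistAmb p = p`                      off `O`,

`σ = ±1` the handedness, `β̂` a smooth plateau function (`0` below `−1/4`, `1` above `1/4`).  Proved here: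
well-definedness (preimages differ by integer `u`-shifts, `Φ` is `1`-periodic); smoothness at the points
of `O` (locally `Γ ∘ shear ∘ L` for a smooth local inverse `L`, `helper_prodChart_localInverse`) and at the
points off the closure of the active part `K = Γ(twistDom ε ∩ {|r| ≤ 1/4})` (where it is the identity);
**every point with `rho ≤ 1/4` is of one of these two kinds** (`mem_image_or_not_mem_closure`: a limit
point of `K` outside `O` has `‖w‖ = 1/2 + ε`, so `rho ≥ ‖w‖² > 1/4` — this is why the twist is spread over
ALL curves `C_{w'}`, `‖w'‖ < 1/2 + ε`, report G6 §3 (i)); `rho ∘ twistAmb = rho` (on `O` the coordinate `w`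
is kept and `‖x‖ < 2` by the margin `(1 + ε) M < 2`, `M` a bound of `‖cx ∘ Φ‖`, report §3 (iii)); the twist
of handedness `−σ` is the inverse.  Package: `helper_twistAmb_package`.  The sequel restricts to a
diffeomorphism of `Base g` and verifies the clauses of node N1a.

Three definitions (`twistDom`, `shearMap`, `twistAmb`); everything else proved; no named facts, no
`sorry`.  Reference: B. Farb, D. Margalit, *A primer on mapping class groups* (2012), §3.1.1 (Dehn
twists) [FarbMargalit2012]. [folklore]
-/

noncomputable section

set_option linter.dupNamespace false

open scoped Manifold ContDiff Topology
open Set Function Metric Complex Filter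
open Literature.Topology.FourManifolds Literature.Topology.FourManifolds.LefschetzBase

namespace Summit.SmoothPoincare4.SmoothPoincare4.Theorems.AcyclicBisectionExists.ModpBraidOrbits

variable {g : ℕ}

/-! ## §1 The domain, the shear and the twist -/

/-- **The domain of the product chart used for the twist**: `‖2w'‖ < 1 + 2ε`, `r ∈ (−1, 1)`. [folklore] -/
def twistDom (ε : ℝ) : Set (ℂ × (ℝ × ℝ)) := {q | ‖2 * q.1‖ < 1 + 2 * ε ∧ q.2.2 ∈ Ioo (-1 : ℝ) 1}

/-- The domain is open. [folklore] -/
theorem isOpen_twistDom (ε : ℝ) : IsOpen (twistDom ε) := by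
  have h1 : Continuous fun q : ℂ × (ℝ × ℝ) => ‖(2 : ℂ) * q.1‖ :=
    continuous_norm.comp ((continuous_const (y := (2 : ℂ))).mul continuous_fst)
  exact (isOpen_lt h1 continuous_const).inter (isOpen_Ioo.preimage (continuous_snd.comp continuous_snd))

/-- Points of the domain have `‖2w'‖ < 2` when `ε ≤ 1/2`. [folklore] -/
theorem lt_two_of_mem_twistDom {ε : ℝ} (hε : ε ≤ 1 / 2) {q : ℂ × (ℝ × ℝ)} (hq : q ∈ twistDom ε) :
    ‖2 * q.1‖ < 2 := by
  have h := hq.1; linarith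

/-- **The shear** `(w', u, r) ↦ (w', u + σ β̂ r, r)`. [folklore] -/
def shearMap (σ : ℝ) (βh : ℝ → ℝ) (q : ℂ × (ℝ × ℝ)) : ℂ × (ℝ × ℝ) := (q.1, (q.2.1 + σ * βh q.2.2, q.2.2))

/-- The shear preserves the domain. [folklore] -/
theorem shearMap_mem {ε σ : ℝ} {βh : ℝ → ℝ} {q : ℂ × (ℝ × ℝ)} (hq : q ∈ twistDom ε) :
    shearMap σ βh q ∈ twistDom ε := hq

/-- The shear is smooth. [folklore] -/
theorem contDiff_shearMap (σ : ℝ) {βh : ℝ → ℝ} (hβ : ContDiff ℝ ∞ βh) : ContDiff ℝ ∞ (shearMap σ βh) := by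
  refine contDiff_fst.prodMk ((?_ : ContDiff ℝ ∞ fun q : ℂ × (ℝ × ℝ) => q.2.1 + σ * βh q.2.2).prodMk
    (contDiff_snd.comp contDiff_snd))
  exact (contDiff_fst.comp contDiff_snd).add (contDiff_const.mul (hβ.comp (contDiff_snd.comp contDiff_snd)))

/-- The shear of the opposite handedness is the inverse. [folklore] -/
theorem shearMap_neg_shearMap (σ : ℝ) (βh : ℝ → ℝ) (q : ℂ × (ℝ × ℝ)) :
    shearMap (-σ) βh (shearMap σ βh q) = q := by
  obtain ⟨w', u, r⟩ := q
  simp only [shearMap]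
  refine Prod.ext rfl (Prod.ext ?_ rfl)
  show u + σ * βh r + -σ * βh r = u
  ring

open Classical in
/-- **The ambient page Dehn twist** of handedness `σ` and profile `β̂` built on the product chart of
the ambient annulus `Φ`: `Γ ∘ shear ∘ Γ⁻¹` on the image `O` of the domain, the identity elsewhere.
[cite: FarbMargalit2012, §3.1.1] -/
def twistAmb (g : ℕ) (Φ : ℝ × ℝ → EuclideanSpace ℝ (Fin 4)) (ε σ : ℝ) (βh : ℝ → ℝ)
    (p : EuclideanSpace ℝ (Fin 4)) : EuclideanSpace ℝ (Fin 4) :=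
  if h : ∃ q ∈ twistDom ε, prodChart g Φ q = p then prodChart g Φ (shearMap σ βh (Classical.choose h)) else p

/-! ## §2 Well-definedness -/

/-- Natural periodicity from `1`-periodicity. [folklore] -/
theorem periodic_nat_of_periodic {α : Type*} {F : ℝ × ℝ → α} (h : ∀ u r, F (u + 1, r) = F (u, r)) (r : ℝ) :
    ∀ (n : ℕ) (u : ℝ), F (u + n, r) = F (u, r) := by
  intro n
  induction n with
  | zero => intro u; rw [Nat.cast_zero, add_zero]
  | succ k ih => intro u; rw [Nat.cast_succ, ← add_assoc, h, ih]

/-- Integer periodicity from `1`-periodicity. [folklore] -/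
theorem periodic_int_of_periodic {α : Type*} {F : ℝ × ℝ → α} (h : ∀ u r, F (u + 1, r) = F (u, r)) (n : ℤ)
    (u r : ℝ) : F (u + n, r) = F (u, r) := by
  obtain ⟨m, rfl | rfl⟩ := Int.eq_nat_or_neg n
  · rw [Int.cast_natCast, periodic_nat_of_periodic h r m u]
  · have h1 := periodic_nat_of_periodic h r m (u + ((-(m : ℤ) : ℤ) : ℝ))
    rw [show u + ((-(m : ℤ) : ℤ) : ℝ) + (m : ℝ) = u by push_cast; ring] at h1
    rw [← h1]

variable {Φ : ℝ × ℝ → EuclideanSpace ℝ (Fin 4)} {ε σ : ℝ} {βh : ℝ → ℝ}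
  (hΦw : ∀ p, w g (Φ p) = 1 / 2) (hΦ1 : ∀ u r, Φ (u + 1, r) = Φ (u, r))
  (hΦi : ∀ p p' : ℝ × ℝ, p.2 ∈ Ioo (-1 : ℝ) 1 → p'.2 ∈ Ioo (-1 : ℝ) 1 → Φ p = Φ p' →
    p.2 = p'.2 ∧ ∃ n : ℤ, p'.1 = p.1 + n)
  (hε : ε ≤ 1 / 2)

section WellDefined
include hΦw hΦ1 hΦi hε

/-- **Well-definedness**: two preimages in the domain of one point give the same twisted point.
[folklore] -/
theorem prodChart_shearMap_eq {q q' : ℂ × (ℝ × ℝ)} (hq : q ∈ twistDom ε) (hq' : q' ∈ twistDom ε)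
    (h : prodChart g Φ q = prodChart g Φ q') :
    prodChart g Φ (shearMap σ βh q) = prodChart g Φ (shearMap σ βh q') := by
  obtain ⟨h1, h2⟩ := prodChart_inj hΦw (lt_two_of_mem_twistDom hε hq) h
  obtain ⟨hr, n, hn⟩ := hΦi q.2 q'.2 hq.2 hq'.2 h2
  rw [prodChart_apply, prodChart_apply]
  simp only [shearMap]
  rw [← h1, ← hr, hn, show q.2.1 + (n : ℝ) + σ * βh q.2.2 = q.2.1 + σ * βh q.2.2 + n by ring,
    periodic_int_of_periodic hΦ1]

/-- **The twist on the image of the domain**: `twistAmb (Γ q) = Γ (shear q)`. [folklore] -/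
theorem twistAmb_prodChart {q : ℂ × (ℝ × ℝ)} (hq : q ∈ twistDom ε) :
    twistAmb g Φ ε σ βh (prodChart g Φ q) = prodChart g Φ (shearMap σ βh q) := by
  have h : ∃ q' ∈ twistDom ε, prodChart g Φ q' = prodChart g Φ q := ⟨q, hq, rfl⟩
  rw [twistAmb, dif_pos h]
  exact prodChart_shearMap_eq hΦw hΦ1 hΦi hε (Classical.choose_spec h).1 hq (Classical.choose_spec h).2

end WellDefined

/-- Off the image of the domain the twist is the identity. [folklore] -/
theorem twistAmb_of_not_mem {p : EuclideanSpace ℝ (Fin 4)} (hp : p ∉ prodChart g Φ '' twistDom ε) :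
    twistAmb g Φ ε σ βh p = p := by
  rw [twistAmb, dif_neg]
  rintro ⟨q, hq, rfl⟩
  exact hp ⟨q, hq, rfl⟩

/-! ## §3 The image of the domain is open; smoothness of the twist there -/

variable (hΦs : ContDiff ℝ ∞ Φ) (hΦd : ∀ p : ℝ × ℝ, p.2 ∈ Ioo (-1 : ℝ) 1 → Injective (fderiv ℝ Φ p))

section Smooth
include hΦs hΦw hΦd hε

/-- **The image `O` of the domain is open** (the product chart is open at every point of the domain).
[cite: LeeSmoothManifolds2013, Thm. 4.5] -/
theorem isOpen_image_twistDom : IsOpen (prodChart g Φ '' twistDom ε) := by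
  rw [isOpen_iff_mem_nhds]
  rintro _ ⟨q, hq, rfl⟩
  have hmap := (helper_prodChart_localInverse g Φ hΦs hΦw q (lt_two_of_mem_twistDom hε hq) (hΦd q.2 hq.2)).1
  rw [← hmap]
  exact image_mem_map ((isOpen_twistDom ε).mem_nhds hq)

include hΦ1 hΦi in
/-- **The twist is smooth at the points of `O`** (locally `Γ ∘ shear ∘ L`). [folklore] -/
theorem contDiffAt_twistAmb_of_mem (hβ : ContDiff ℝ ∞ βh) {p : EuclideanSpace ℝ (Fin 4)}
    (hp : p ∈ prodChart g Φ '' twistDom ε) : ContDiffAt ℝ ∞ (twistAmb g Φ ε σ βh) p := by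
  obtain ⟨q, hq, rfl⟩ := hp
  obtain ⟨-, L, hLs, hLq, -, hright⟩ :=
    helper_prodChart_localInverse g Φ hΦs hΦw q (lt_two_of_mem_twistDom hε hq) (hΦd q.2 hq.2)
  have hLmem : ∀ᶠ y in 𝓝 (prodChart g Φ q), L y ∈ twistDom ε :=
    hLs.continuousAt.preimage_mem_nhds (by rw [hLq]; exact (isOpen_twistDom ε).mem_nhds hq)
  have hev : twistAmb g Φ ε σ βh =ᶠ[𝓝 (prodChart g Φ q)]
      fun y => prodChart g Φ (shearMap σ βh (L y)) := by
    filter_upwards [hLmem, hright] with y hy hyr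
    have h := twistAmb_prodChart hΦw hΦ1 hΦi hε (σ := σ) (βh := βh) hy
    rwa [hyr] at h
  refine ContDiffAt.congr_of_eventuallyEq ?_ hev
  have h1 : ContDiffAt ℝ ∞ (fun y => shearMap σ βh (L y)) (prodChart g Φ q) :=
    (contDiff_shearMap σ hβ).contDiffAt.comp _ hLs
  have h2 : ContDiffAt ℝ ∞ (prodChart g Φ) (shearMap σ βh (L (prodChart g Φ q))) := by
    rw [hLq]
    exact contDiffAt_prodChart hΦs (lt_two_of_mem_twistDom hε (shearMap_mem hq))
  exact ContDiffAt.comp (prodChart g Φ q) (g := prodChart g Φ) (f := fun y => shearMap σ βh (L y)) h2 h1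

end Smooth

/-! ## §4 The identity off the active part -/

section Active
include hΦw hΦ1 hΦi hε

/-- **Off the active part `K = Γ(twistDom ε ∩ {|r| ≤ 1/4})` the twist is the identity** (there the
profile is `0` or `1`, and a full turn is absorbed by periodicity). [folklore] -/
theorem twistAmb_eq_self (hβ0 : ∀ r ≤ -(1 / 4 : ℝ), βh r = 0) (hβ1 : ∀ r ≥ (1 / 4 : ℝ), βh r = 1)
    (hσ : σ = 1 ∨ σ = -1) {p : EuclideanSpace ℝ (Fin 4)}
    (hp : p ∉ prodChart g Φ '' (twistDom ε ∩ {q | |q.2.2| ≤ 1 / 4})) : twistAmb g Φ ε σ βh p = p := by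
  by_cases hO : p ∈ prodChart g Φ '' twistDom ε
  · obtain ⟨q, hq, rfl⟩ := hO
    rw [twistAmb_prodChart hΦw hΦ1 hΦi hε hq, prodChart_apply, prodChart_apply]
    have hna : ¬|q.2.2| ≤ 1 / 4 := fun h => hp ⟨q, ⟨hq, h⟩, rfl⟩
    simp only [shearMap]
    rcases lt_or_gt_of_ne (fun h : |q.2.2| = 1 / 4 => hna h.le) with hlt | hgt
    · exact absurd hlt.le hna
    · rcases le_or_gt 0 q.2.2 with h0 | h0
      · rw [abs_of_nonneg h0] at hgt
        rw [hβ1 _ hgt.le, mul_one]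
        rcases hσ with rfl | rfl
        · rw [show q.2.1 + (1 : ℝ) = q.2.1 + ((1 : ℤ) : ℝ) by push_cast; ring, periodic_int_of_periodic hΦ1]
        · rw [show q.2.1 + (-1 : ℝ) = q.2.1 + ((-1 : ℤ) : ℝ) by push_cast; ring, periodic_int_of_periodic hΦ1]
      · rw [abs_of_neg h0] at hgt
        rw [hβ0 _ (by linarith), mul_zero, add_zero]
  · exact twistAmb_of_not_mem hO

/-- Hence the twist is smooth off the closure of the active part. [folklore] -/
theorem contDiffAt_twistAmb_of_not_mem_closure (hβ0 : ∀ r ≤ -(1 / 4 : ℝ), βh r = 0)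
    (hβ1 : ∀ r ≥ (1 / 4 : ℝ), βh r = 1) (hσ : σ = 1 ∨ σ = -1) {p : EuclideanSpace ℝ (Fin 4)}
    (hp : p ∉ closure (prodChart g Φ '' (twistDom ε ∩ {q | |q.2.2| ≤ 1 / 4}))) :
    ContDiffAt ℝ ∞ (twistAmb g Φ ε σ βh) p := by
  refine contDiffAt_id.congr_of_eventuallyEq ?_
  filter_upwards [isClosed_closure.isOpen_compl.mem_nhds hp] with y hy
  exact twistAmb_eq_self hΦw hΦ1 hΦi hε hβ0 hβ1 hσ fun h => hy (subset_closure h)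

end Active

/-! ## §5 Every point of the base is in `O` or off the closure of the active part -/

/-- `rho ≥ ‖w‖²`. [folklore] -/
theorem normSq_w_le_rho (p : EuclideanSpace ℝ (Fin 4)) : ‖w g p‖ ^ 2 ≤ rho g p := by
  rw [rho]
  have h : 0 ≤ LefschetzBase.eta (‖cx p‖ ^ 2) := expNegInvGlue.nonneg _
  linarith

section Closure
include hΦs hΦw hΦ1

/-- **The dichotomy on the base**: a point with `rho ≤ 1/4` lies in the open image `O` of the domain or
off the closure of the active part (a limit point of the active part outside `O` has `‖w‖ = 1/2 + ε`).
[folklore] -/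
theorem mem_image_or_not_mem_closure (hε0 : 0 < ε) (hε2 : ε < 1 / 2) {p : EuclideanSpace ℝ (Fin 4)}
    (hp : rho g p ≤ 1 / 4) :
    p ∈ prodChart g Φ '' twistDom ε ∨ p ∉ closure (prodChart g Φ '' (twistDom ε ∩ {q | |q.2.2| ≤ 1 / 4})) := by
  by_cases hO : p ∈ prodChart g Φ '' twistDom ε
  · exact Or.inl hO
  refine Or.inr fun hcl => ?_
  -- a compact set of parameters whose image contains the active part
  set C : Set (ℂ × (ℝ × ℝ)) :=
    Metric.closedBall (0 : ℂ) ((1 + 2 * ε) / 2) ×ˢ (Icc (0 : ℝ) 1 ×ˢ Icc (-(1 / 4) : ℝ) (1 / 4)) with hC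
  have hCc : IsCompact C := (isCompact_closedBall _ _).prod (isCompact_Icc.prod isCompact_Icc)
  have hcont : ContinuousOn (prodChart g Φ) C := fun q hq => by
    refine (contDiffAt_prodChart hΦs ?_).continuousAt.continuousWithinAt
    have h1 : ‖q.1‖ ≤ (1 + 2 * ε) / 2 := mem_closedBall_zero_iff.1 hq.1
    rw [norm_mul, Complex.norm_two]; linarith
  have hsub : prodChart g Φ '' (twistDom ε ∩ {q | |q.2.2| ≤ 1 / 4}) ⊆ prodChart g Φ '' C := by
    rintro _ ⟨q, ⟨hq, hqa⟩, rfl⟩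
    refine ⟨(q.1, (Int.fract q.2.1, q.2.2)), ⟨?_, ⟨Int.fract_nonneg _, (Int.fract_lt_one _).le⟩, abs_le.1 hqa⟩, ?_⟩
    · rw [mem_closedBall_zero_iff]
      have h := hq.1; rw [norm_mul, Complex.norm_two] at h; linarith
    · rw [prodChart_apply, prodChart_apply, Int.fract, show q.2.1 - (⌊q.2.1⌋ : ℝ) = q.2.1 + ((-⌊q.2.1⌋ : ℤ) : ℝ) by
        push_cast; ring, periodic_int_of_periodic hΦ1]
  have hcl' : p ∈ prodChart g Φ '' C :=
    (closure_minimal hsub (hCc.image_of_continuousOn hcont).isClosed) hcl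
  obtain ⟨q, hqC, rfl⟩ := hcl'
  -- this parameter is not in the domain, so `‖2 w'‖ = 1 + 2ε`
  have hr : q.2.2 ∈ Ioo (-1 : ℝ) 1 := ⟨by linarith [hqC.2.2.1], by linarith [hqC.2.2.2]⟩
  have hnot : ¬‖2 * q.1‖ < 1 + 2 * ε := fun h => hO ⟨q, ⟨h, hr⟩, rfl⟩
  have hw : ‖w g (prodChart g Φ q)‖ ≥ 1 / 2 + ε := by
    rw [w_prodChart hΦw]
    rw [norm_mul, Complex.norm_two] at hnot
    linarith [not_lt.1 hnot]
  have h2 := normSq_w_le_rho (g := g) (prodChart g Φ q)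
  nlinarith

end Closure

/-! ## §6 `rho` is preserved; the inverse -/

/-- `‖λ(c)‖ = ‖1 + c/2‖^{1/(2g+1)}`. [folklore] -/
theorem norm_scaleX (c : ℂ) : ‖scaleX g c‖ = ‖1 + c / 2‖ ^ ((2 * g + 1 : ℝ))⁻¹ := by
  have hy : ((2 * g + 1 : ℕ) : ℂ)⁻¹ = (((2 * g + 1 : ℝ))⁻¹ : ℝ) := by push_cast; ring
  rw [scaleX, hy, Complex.norm_cpow_real]

/-- **The `x`-scaling ratio is at most `1 + ε`** on the domain (`‖(1 + w')/(3/2)‖^{1/(2g+1)} ≤ 1 + 2ε/3`).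
[folklore] -/
theorem norm_scaleX_ratio_le (hε0 : 0 ≤ ε) {w' : ℂ} (hw' : ‖2 * w'‖ < 1 + 2 * ε) :
    ‖scaleX g (2 * w') / scaleX g 1‖ ≤ 1 + ε := by
  rw [norm_div, norm_scaleX, norm_scaleX, ← Real.div_rpow (norm_nonneg _) (norm_nonneg _)]
  set e : ℝ := ((2 * g + 1 : ℝ))⁻¹ with he
  have he0 : 0 < e := by rw [he]; positivity
  have he1 : e ≤ 1 := by
    rw [he]; exact inv_le_one_of_one_le₀ (by have := Nat.cast_nonneg (α := ℝ) g; linarith)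
  have hb0 : 0 ≤ ‖1 + 2 * w' / 2‖ / ‖(1 : ℂ) + 1 / 2‖ := by positivity
  have hden : ‖(1 : ℂ) + 1 / 2‖ = 3 / 2 := by
    rw [show (1 : ℂ) + 1 / 2 = ((3 / 2 : ℝ) : ℂ) by push_cast; ring, Complex.norm_real]; norm_num
  have hnum : ‖1 + 2 * w' / 2‖ ≤ 3 / 2 + ε := by
    have h1 : ‖1 + 2 * w' / 2‖ ≤ ‖(1 : ℂ)‖ + ‖2 * w' / 2‖ := norm_add_le _ _
    rw [norm_one, norm_div, Complex.norm_two] at h1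
    linarith
  have hb : ‖1 + 2 * w' / 2‖ / ‖(1 : ℂ) + 1 / 2‖ ≤ 1 + ε := by
    rw [hden, div_le_iff₀ (by norm_num : (0 : ℝ) < 3 / 2)]; linarith
  rcases le_or_gt (‖1 + 2 * w' / 2‖ / ‖(1 : ℂ) + 1 / 2‖) 1 with hle | hgt
  · exact (Real.rpow_le_one hb0 hle he0.le).trans (by linarith)
  · calc (‖1 + 2 * w' / 2‖ / ‖(1 : ℂ) + 1 / 2‖) ^ e ≤ (‖1 + 2 * w' / 2‖ / ‖(1 : ℂ) + 1 / 2‖) ^ (1 : ℝ) :=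
          Real.rpow_le_rpow_of_exponent_le hgt.le he1
      _ ≤ 1 + ε := by rw [Real.rpow_one]; exact hb

/-- **Points of `O` lie over `‖x‖ < 2`** when `‖cx ∘ Φ‖ ≤ M` on the annulus and `(1 + ε) M < 2`.
[folklore] -/
theorem norm_cx_prodChart_lt (hε0 : 0 ≤ ε) {M : ℝ} (hM : ∀ p : ℝ × ℝ, p.2 ∈ Ioo (-1 : ℝ) 1 → ‖cx (Φ p)‖ ≤ M)
    (hMε : (1 + ε) * M < 2) {q : ℂ × (ℝ × ℝ)} (hq : q ∈ twistDom ε) : ‖cx (prodChart g Φ q)‖ < 2 := by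
  rw [prodChart_apply, cx_sclL, norm_mul]
  have h1 := norm_scaleX_ratio_le (g := g) hε0 hq.1
  have h2 := hM q.2 hq.2
  have hM0 : 0 ≤ M := (norm_nonneg _).trans h2
  calc ‖scaleX g (2 * q.1) / scaleX g 1‖ * ‖cx (Φ q.2)‖ ≤ (1 + ε) * M :=
        mul_le_mul h1 h2 (norm_nonneg _) (by linarith)
    _ < 2 := hMε

/-- Over `‖x‖ < 2` the cut-off vanishes: `rho = ‖w‖²`. [folklore] -/
theorem rho_eq_of_norm_cx_lt {p : EuclideanSpace ℝ (Fin 4)} (h : ‖cx p‖ < 2) : rho g p = ‖w g p‖ ^ 2 := by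
  rw [rho, eta_of_le (by nlinarith [norm_nonneg (cx p)]), add_zero]

section Rho
include hΦw hΦ1 hΦi hε

/-- **The twist preserves `rho`.** [folklore] -/
theorem rho_twistAmb (hε0 : 0 ≤ ε) {M : ℝ} (hM : ∀ p : ℝ × ℝ, p.2 ∈ Ioo (-1 : ℝ) 1 → ‖cx (Φ p)‖ ≤ M)
    (hMε : (1 + ε) * M < 2) (p : EuclideanSpace ℝ (Fin 4)) :
    rho g (twistAmb g Φ ε σ βh p) = rho g p := by
  by_cases hO : p ∈ prodChart g Φ '' twistDom ε
  · obtain ⟨q, hq, rfl⟩ := hO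
    rw [twistAmb_prodChart hΦw hΦ1 hΦi hε hq,
      rho_eq_of_norm_cx_lt (norm_cx_prodChart_lt hε0 hM hMε (shearMap_mem hq)),
      rho_eq_of_norm_cx_lt (norm_cx_prodChart_lt hε0 hM hMε hq), w_prodChart hΦw, w_prodChart hΦw]
    rfl
  · rw [twistAmb_of_not_mem hO]

/-- The twist maps `O` into `O`. [folklore] -/
theorem twistAmb_mem_image {p : EuclideanSpace ℝ (Fin 4)} (hp : p ∈ prodChart g Φ '' twistDom ε) :
    twistAmb g Φ ε σ βh p ∈ prodChart g Φ '' twistDom ε := by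
  obtain ⟨q, hq, rfl⟩ := hp
  rw [twistAmb_prodChart hΦw hΦ1 hΦi hε hq]
  exact ⟨_, shearMap_mem hq, rfl⟩

/-- **The twist of the opposite handedness is the inverse.** [folklore] -/
theorem twistAmb_neg_twistAmb (p : EuclideanSpace ℝ (Fin 4)) :
    twistAmb g Φ ε (-σ) βh (twistAmb g Φ ε σ βh p) = p := by
  by_cases hO : p ∈ prodChart g Φ '' twistDom ε
  · obtain ⟨q, hq, rfl⟩ := hO
    rw [twistAmb_prodChart hΦw hΦ1 hΦi hε hq, twistAmb_prodChart hΦw hΦ1 hΦi hε (shearMap_mem hq),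
      shearMap_neg_shearMap]
  · rw [twistAmb_of_not_mem hO, twistAmb_of_not_mem hO]

end Rho

/-! ## The registered form -/

/-- **Sub-goal `helper_twistAmb_package`** (G6-6, second piece of (R-TWIST) for node N3a): for a smooth
`1`-periodic ambient annulus `Φ` of the page of direction `1`, injective modulo `ℤ` with injective
differential on `r ∈ (−1, 1)` and `‖cx ∘ Φ‖ ≤ M`, a margin `0 < ε < 1/2` with `(1 + ε) M < 2`, a
handedness `σ = ±1` and a smooth plateau profile `β̂`, the ambient twist `twistAmb g Φ ε σ β̂` is smooth
at every point of the base `{rho ≤ 1/4}`, preserves `rho`, is inverted by the twist of handedness `−σ`,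
is `Γ ∘ shear` on the product chart and the identity off its image. [cite: FarbMargalit2012, §3.1.1] -/
theorem helper_twistAmb_package : ∀ (g : ℕ) (Φ : ℝ × ℝ → EuclideanSpace ℝ (Fin 4)) (ε σ M : ℝ) (βh : ℝ → ℝ), ContDiff ℝ ∞ Φ → (∀ p, Literature.Topology.FourManifolds.LefschetzBase.w g (Φ p) = 1 / 2) → (∀ u r, Φ (u + 1, r) = Φ (u, r)) → (∀ p p' : ℝ × ℝ, p.2 ∈ Set.Ioo (-1 : ℝ) 1 → p'.2 ∈ Set.Ioo (-1 : ℝ) 1 → Φ p = Φ p' → p.2 = p'.2 ∧ ∃ n : ℤ, p'.1 = p.1 + n) → (∀ p : ℝ × ℝ, p.2 ∈ Set.Ioo (-1 : ℝ) 1 → Function.Injective (fderiv ℝ Φ p)) → 0 < ε → ε < 1 / 2 → (σ = 1 ∨ σ = -1) → ContDiff ℝ ∞ βh → (∀ r ≤ -(1 / 4 : ℝ), βh r = 0) → (∀ r ≥ (1 / 4 : ℝ), βh r = 1) → (∀ p : ℝ × ℝ, p.2 ∈ Set.Ioo (-1 : ℝ) 1 → ‖Literature.Topology.FourManifolds.LefschetzBase.cx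 (Φ p)‖ ≤ M) → (1 + ε) * M < 2 → (∀ p : EuclideanSpace ℝ (Fin 4), Literature.Topology.FourManifolds.LefschetzBase.rho g p ≤ 1 / 4 → ContDiffAt ℝ ∞ (Summit.SmoothPoincare4.SmoothPoincare4.Theorems.AcyclicBisectionExists.ModpBraidOrbits.twistAmb g Φ ε σ βh) p) ∧ (∀ p, Literature.Topology.FourManifolds.LefschetzBase.rho g (Summit.SmoothPoincare4.SmoothPoincare4.Theorems.AcyclicBisectionExists.ModpBraidOrbits.twistAmb g Φ ε σ βh p) = Literature.Topology.FourManifolds.LefschetzBase.rho g p) ∧ (∀ p, Summit.SmoothPoincare4.SmoothPoincare4.Theorems.AcyclicBisectionExists.ModpBraidOrbits.twistAmb g Φ ε (-σ) βh (Summit.SmoothPoincare4.SmoothPoincare4.Theorems.AcyclicBisectionExists.ModpBraidOrbits.twistAmb g Φ ε σ βh p) = p) ∧ (∀ p, Summit.SmoothPoincare4.SmoothPoincare4.Theorems.AcyclicBisectionExists.ModpBraidOrbits.twistAmb g Φ ε σ βh (Summit.SmoothPoincare4.SmoothPoincare4.Theorems.AcyclicBisectionExists.ModpBraidOrbits.twistAmb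 g Φ ε (-σ) βh p) = p) ∧ (∀ q ∈ Summit.SmoothPoincare4.SmoothPoincare4.Theorems.AcyclicBisectionExists.ModpBraidOrbits.twistDom ε, Summit.SmoothPoincare4.SmoothPoincare4.Theorems.AcyclicBisectionExists.ModpBraidOrbits.twistAmb g Φ ε σ βh (Summit.SmoothPoincare4.SmoothPoincare4.Theorems.AcyclicBisectionExists.ModpBraidOrbits.prodChart g Φ q) = Summit.SmoothPoincare4.SmoothPoincare4.Theorems.AcyclicBisectionExists.ModpBraidOrbits.prodChart g Φ (Summit.SmoothPoincare4.SmoothPoincare4.Theorems.AcyclicBisectionExists.ModpBraidOrbits.shearMap σ βh q)) ∧ (∀ p, p ∉ Summit.SmoothPoincare4.SmoothPoincare4.Theorems.AcyclicBisectionExists.ModpBraidOrbits.prodChart g Φ '' Summit.SmoothPoincare4.SmoothPoincare4.Theorems.AcyclicBisectionExists.ModpBraidOrbits.twistDom ε → Summit.SmoothPoincare4.SmoothPoincare4.Theorems.AcyclicBisectionExists.ModpBraidOrbits.twistAmb g Φ ε σ βh p = p) := by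
  intro g Φ ε σ M βh hΦs hΦw hΦ1 hΦi hΦd hε0 hε2 hσ hβ hβ0 hβ1 hM hMε
  have hε : ε ≤ 1 / 2 := hε2.le
  refine ⟨fun p hp => ?_, rho_twistAmb hΦw hΦ1 hΦi hε hε0.le hM hMε,
    twistAmb_neg_twistAmb hΦw hΦ1 hΦi hε, fun p => ?_,
    fun q hq => twistAmb_prodChart hΦw hΦ1 hΦi hε hq, fun p hp => twistAmb_of_not_mem hp⟩
  · rcases mem_image_or_not_mem_closure hΦw hΦ1 hΦs hε0 hε2 hp with hO | hcl
    · exact contDiffAt_twistAmb_of_mem hΦw hΦ1 hΦi hε hΦs hΦd hβ hO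
    · exact contDiffAt_twistAmb_of_not_mem_closure hΦw hΦ1 hΦi hε hβ0 hβ1 hσ hcl
  · have h := twistAmb_neg_twistAmb hΦw hΦ1 hΦi hε (σ := -σ) (βh := βh) p
    rwa [neg_neg] at h

end Summit.SmoothPoincare4.SmoothPoincare4.Theorems.AcyclicBisectionExists.ModpBraidOrbits

end
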